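import Summits.Ventures.PercRepro.Night2FatXTwoPlanesA

/-!
# night-2: a lossy big pair without good points covers `H₀` by two planes through its line

In the fat case `G ∖ clF B₀ = {w₀, x}` a lossy big pair `(B, z)` without good points has exactly one off-point
`u` outside `Q = B ∪ {z}`; the other, `v`, is a coloop of `Q' = Q ∖ K` and the face `Q ∖ v` has the fat closure
`clF B₀` (`exists_off_coloop_of_no_gtPts`).  Every point `e` of `V = G ∖ K` other than `w₀, x` lies in `clF B₀`,
and — without good points — on a second face hyperplane `cl (Q ∖ c₂)` or `cl (Q ∖ c₃)` (`c₂, c₃` the two other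
coloops of `Q'`); two of the three face hyperplanes meet in the rank-`4` flat spanned by the line `R = Q' ∖ coloops Q'`,
the third coloop and `K` (modularity, `mem_clF_of_mem_clF_of_mem_clF`), so **`two_planes_of_no_gtPts`**:
`V ∖ {w₀, x} ⊆ cl (R ∪ {c₂}) ∪ cl (R ∪ {c₃})` — the hyperplane `H₀` is the union of the two planes through `R` and
`c₂`, `c₃`.  Together with `rkN_line_off_le_three_of_no_gtPts` this is the complete geometry of a distance-2
source above `Q ∪ {x}`: the whole of `H₀` lies on two planes through a line coplanar with `w₀` and `x`.
Paper `proofs/NIGHT-2-g33.md` §4.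
-/

namespace PercRepro.Shadow

open PercRepro.ThmH PercRepro.PerFlat

variable {α : Type*} [DecidableEq α] {M : Matroid α} [M.Finite] {G : Finset α}

/-- **Two planes through the line cover `V ∖ {w₀, x}`**: for a lossy big pair `(B, z)` without good points, with
line `R = Q' ∖ coloops Q'` and the two coloops `c₂ ≠ c₃` of `Q'` off `{w₀, x}`, every point of `V = G ∖ K` other
than `w₀, x` lies in `cl (R ∪ {c₂})` or `cl (R ∪ {c₃})`. -/
theorem two_planes_of_no_gtPts (hG : G ∈ flatsQ M (5 + 1)) (hd : (gr M \ G).card = 2)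
    (hk : kColoops M G = 1) (hs : ∀ e ∈ gr M, ∀ f ∈ gr M, e ≠ f → rkN M {e, f} = 2)
    (hl : ∀ e ∈ gr M, M.Indep {e}) {B₀ : Finset α} (hB₀ : B₀ ∈ thinMembers M 5 G) {w₀ x : α}
    (hD : G \ clF M B₀ = {w₀, x}) {B : Finset α} (hB : B ∈ thinMembers M 5 G)
    (hbig : 5 ≤ (B \ coloops M G).card) {z : α} (hz : z ∈ G \ clF M B) (h : loss M 5 G B z ≠ 0)
    (hno : ¬ (gtPts M 5 G (insert z B)).Nonempty) :
    ∃ c₂ ∈ coloops M (insert z B \ coloops M G), ∃ c₃ ∈ coloops M (insert z B \ coloops M G), c₂ ≠ c₃ ∧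
      c₂ ∉ ({w₀, x} : Finset α) ∧ c₃ ∉ ({w₀, x} : Finset α) ∧
      ∀ e ∈ G \ coloops M G, e ∉ ({w₀, x} : Finset α) →
        e ∈ clF M (insert c₂ ((insert z B \ coloops M G) \ coloops M (insert z B \ coloops M G))) ∨
        e ∈ clF M (insert c₃ ((insert z B \ coloops M G) \ coloops M (insert z B \ coloops M G))) := by
  obtain ⟨u, v, huv, huQ, hvC, hclv⟩ := exists_off_coloop_of_no_gtPts hG hd hk hs hl hB₀ hD hB hbig hz h hno
  have hGg : G ⊆ gr M := (mem_flatsQ.1 hG).1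
  have hd' : (gr M \ G).card ≤ 5 := by omega
  have hQG : insert z B ⊆ G :=
    Finset.insert_subset (Finset.mem_sdiff.1 hz).1 (subset_G_of_mem_thinMembers hB)
  have hKQ : coloops M G ⊆ insert z B :=
    (coloops_subset_of_mem_thinMembers hG hd' hB).trans (Finset.subset_insert _ _)
  have hQ'G : insert z B \ coloops M G ⊆ G := Finset.sdiff_subset.trans hQG
  have hQ'5 : rkN M (insert z B \ coloops M G) = 5 := rkN_insert_sdiff_coloops_eq_five_of_thin hG hd hk hB hz
  have hk' : (coloops M G).card = 1 := by
    rw [← kColoops_eq_card_coloops]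
    exact hk
  obtain ⟨e₀, he₀⟩ := Finset.card_eq_one.1 hk'
  have hfaces := thinFacesOf_eq_image_erase hG hd hk hs hl hB hbig hz h
  have hc3 : (coloops M (insert z B \ coloops M G)).card = 3 :=
    card_coloops_eq_three_of_loss_ne_zero hG hd hk hs hl hB hbig hz h
  obtain ⟨hR2, -⟩ := rkN_sdiff_coloops_eq_two_of_loss_ne_zero hG hd hk hs hl hB hbig hz h
  obtain ⟨R, hRdef⟩ : ∃ R : Finset α,
      R = (insert z B \ coloops M G) \ coloops M (insert z B \ coloops M G) := ⟨_, rfl⟩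
  rw [← hRdef] at hR2 ⊢
  have hRQ' : R ⊆ insert z B \ coloops M G := by
    rw [hRdef]
    exact Finset.sdiff_subset
  have hRG : R ⊆ G := hRQ'.trans hQ'G
  -- the two other coloops
  have h2 : ((coloops M (insert z B \ coloops M G)).erase v).card = 2 := by
    rw [Finset.card_erase_of_mem hvC, hc3]
  obtain ⟨c₂, c₃, hc23, hpair⟩ := Finset.card_eq_two.1 h2
  have hmemC : ∀ c, c ∈ coloops M (insert z B \ coloops M G) → c ≠ v → c = c₂ ∨ c = c₃ := by
    intro c hc hcv
    have : c ∈ (coloops M (insert z B \ coloops M G)).erase v := Finset.mem_erase.2 ⟨hcv, hc⟩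
    rw [hpair, Finset.mem_insert, Finset.mem_singleton] at this
    exact this
  have hc₂v : c₂ ≠ v := by
    have : c₂ ∈ (coloops M (insert z B \ coloops M G)).erase v := by
      rw [hpair]
      exact Finset.mem_insert_self _ _
    exact (Finset.mem_erase.1 this).1
  have hc₃v : c₃ ≠ v := by
    have : c₃ ∈ (coloops M (insert z B \ coloops M G)).erase v := by
      rw [hpair]
      exact Finset.mem_insert_of_mem (Finset.mem_singleton_self _)
    exact (Finset.mem_erase.1 this).1
  have hc₂C : c₂ ∈ coloops M (insert z B \ coloops M G) := by
    have : c₂ ∈ (coloops M (insert z B \ coloops M G)).erase v := by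
      rw [hpair]
      exact Finset.mem_insert_self _ _
    exact Finset.mem_of_mem_erase this
  have hc₃C : c₃ ∈ coloops M (insert z B \ coloops M G) := by
    have : c₃ ∈ (coloops M (insert z B \ coloops M G)).erase v := by
      rw [hpair]
      exact Finset.mem_insert_of_mem (Finset.mem_singleton_self _)
    exact Finset.mem_of_mem_erase this
  have hvQ : v ∈ insert z B := (Finset.mem_sdiff.1 (mem_coloops.1 hvC).1).1
  have hvK : v ∉ coloops M G := (Finset.mem_sdiff.1 (mem_coloops.1 hvC).1).2
  -- a coloop of `Q'` is not an off-point
  have hoffC : ∀ c, c ∈ coloops M (insert z B \ coloops M G) → c ≠ v → c ∉ ({w₀, x} : Finset α) := by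
    intro c hc hcv hmem
    rw [huv, Finset.mem_insert, Finset.mem_singleton] at hmem
    rcases hmem with rfl | rfl
    · exact huQ (Finset.mem_sdiff.1 (mem_coloops.1 hc).1).1
    · exact hcv rfl
  refine ⟨c₂, hc₂C, c₃, hc₃C, hc23, hoffC c₂ hc₂C hc₂v, hoffC c₃ hc₃C hc₃v, ?_⟩
  intro e he heoff
  have heG : e ∈ G := (Finset.mem_sdiff.1 he).1
  have heK : e ∉ coloops M G := (Finset.mem_sdiff.1 he).2
  have hecl : e ∈ clF M B₀ := by
    by_contra hc
    have : e ∈ G \ clF M B₀ := Finset.mem_sdiff.2 ⟨heG, hc⟩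
    rw [hD] at this
    exact heoff this
  have hRsub : ∀ c, R ⊆ insert c R := fun c => Finset.subset_insert _ _
  have hclsub : ∀ c, c ∈ insert z B → insert c R ⊆ clF M (insert c R) := fun c hc =>
    subset_clF_of_subset_gr (M := M) (Finset.insert_subset (hGg (hQG hc)) (hRG.trans hGg))
  by_cases heQ : e ∈ insert z B
  · -- a point of `Q'`: on the line, or one of the two coloops
    have heQ' : e ∈ insert z B \ coloops M G := Finset.mem_sdiff.2 ⟨heQ, heK⟩
    by_cases heC : e ∈ coloops M (insert z B \ coloops M G)
    · have hev : e ≠ v := by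
        intro h'
        apply heoff
        rw [huv, h']
        exact Finset.mem_insert_of_mem (Finset.mem_singleton_self _)
      rcases hmemC e heC hev with rfl | rfl
      · exact Or.inl (hclsub e heQ (Finset.mem_insert_self _ _))
      · exact Or.inr (hclsub e heQ (Finset.mem_insert_self _ _))
    · have heR : e ∈ R := by
        rw [hRdef]
        exact Finset.mem_sdiff.2 ⟨heQ', heC⟩
      exact Or.inl (hclsub c₂ (Finset.mem_sdiff.1 (mem_coloops.1 hc₂C).1).1 (Finset.mem_insert_of_mem heR))
  · -- a point outside `Q`: on a second face hyperplane, hence on the plane through `R` and the third coloop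
    have heGQ : e ∈ G \ insert z B := Finset.mem_sdiff.2 ⟨heG, heQ⟩
    have hsecond : e ∈ clF M ((insert z B).erase c₂) ∨ e ∈ clF M ((insert z B).erase c₃) := by
      by_contra hboth
      have h₂ : e ∉ clF M ((insert z B).erase c₂) := fun h' => hboth (Or.inl h')
      have h₃ : e ∉ clF M ((insert z B).erase c₃) := fun h' => hboth (Or.inr h')
      apply hno
      refine ⟨e, mem_goodPts.2 ⟨heGQ, ?_⟩⟩
      have hsub : (thinFacesOf M 5 G (insert z B)).filter (fun F => e ∈ clF M F) ⊆ {(insert z B).erase v} := by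
        intro F hF
        rw [Finset.mem_filter, hfaces, Finset.mem_image] at hF
        obtain ⟨⟨c, hc, rfl⟩, heF⟩ := hF
        rw [Finset.mem_singleton]
        by_cases hcv : c = v
        · rw [hcv]
        · rcases hmemC c hc hcv with rfl | rfl
          · exact absurd heF h₂
          · exact absurd heF h₃
      have := Finset.card_le_card hsub
      rw [Finset.card_singleton] at this
      exact this
    -- the modular step, symmetric in `c₂, c₃`
    have step : ∀ c c' : α, c ∈ coloops M (insert z B \ coloops M G) →
        c' ∈ coloops M (insert z B \ coloops M G) → c ≠ v → c' ≠ v → c ≠ c' →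
        (∀ a, a ∈ coloops M (insert z B \ coloops M G) → a ≠ v → a = c ∨ a = c') →
        e ∈ clF M ((insert z B).erase c) → e ∈ clF M (insert c' R) := by
      intro c c' hcC hc'C hcv hc'v hcc' hmem' hec
      have hcQ : c ∈ insert z B := (Finset.mem_sdiff.1 (mem_coloops.1 hcC).1).1
      have hcK : c ∉ coloops M G := (Finset.mem_sdiff.1 (mem_coloops.1 hcC).1).2
      have hc'Q : c' ∈ insert z B := (Finset.mem_sdiff.1 (mem_coloops.1 hc'C).1).1
      have hc'K : c' ∉ coloops M G := (Finset.mem_sdiff.1 (mem_coloops.1 hc'C).1).2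
      -- `e` lies on the fat face at `v`
      have hev : e ∈ clF M ((insert z B).erase v) := by
        rw [hclv]
        exact hecl
      -- `Z = (Q ∖ v) ∖ c = R ∪ {c'} ∪ K`
      have hZ : ((insert z B).erase v).erase c = insert e₀ (insert c' R) := by
        ext a
        simp only [Finset.mem_erase, Finset.mem_insert]
        constructor
        · rintro ⟨hac, hav, haQ⟩
          have haQ'' : a ∈ insert z B := Finset.mem_insert.2 haQ
          by_cases haK : a ∈ coloops M G
          · left
            rw [he₀] at haK
            exact Finset.mem_singleton.1 haK
          · right
            have haQ' : a ∈ insert z B \ coloops M G := Finset.mem_sdiff.2 ⟨haQ'', haK⟩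
            by_cases haC : a ∈ coloops M (insert z B \ coloops M G)
            · left
              rcases hmem' a haC hav with h' | h'
              · exact absurd h' hac
              · exact h'
            · right
              rw [hRdef]
              exact Finset.mem_sdiff.2 ⟨haQ', haC⟩
        · rintro (rfl | rfl | haR)
          · have he₀K : a ∈ coloops M G := by
              rw [he₀]
              exact Finset.mem_singleton_self _
            exact ⟨fun h' => hcK (h' ▸ he₀K), fun h' => hvK (h' ▸ he₀K), Finset.mem_insert.1 (hKQ he₀K)⟩
          · exact ⟨fun h' => hcc' h'.symm, hc'v, Finset.mem_insert.1 hc'Q⟩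
          · have haQ' := hRQ' haR
            have haC : a ∉ coloops M (insert z B \ coloops M G) := by
              rw [hRdef] at haR
              exact (Finset.mem_sdiff.1 haR).2
            exact ⟨fun h' => haC (h' ▸ hcC), fun h' => haC (h' ▸ hvC),
              Finset.mem_insert.1 (Finset.mem_sdiff.1 haQ').1⟩
      -- ranks: the faces have rank `5`, `Q` rank `6`, `Z` rank `4`
      have hrkv := rkN_erase_coloop_face_eq_five hG hd hk hB hz hvC
      have hrkc := rkN_erase_coloop_face_eq_five hG hd hk hB hz hcC
      have hrkQ : rkN M (insert z B) = 6 := by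
        rw [rkN_eq_rkN_sdiff_add_one hG hk hQG (Finset.Subset.refl _) hKQ, hQ'5]
      have hunion : (insert z B).erase v ∪ (insert z B).erase c = insert z B := by
        ext a
        simp only [Finset.mem_union, Finset.mem_erase]
        constructor
        · rintro (⟨-, h'⟩ | ⟨-, h'⟩) <;> exact h'
        · intro haQ
          by_cases hav : a = v
          · exact Or.inr ⟨fun h' => hcv (h'.symm.trans hav), haQ⟩
          · exact Or.inl ⟨hav, haQ⟩
      have hc'R : c' ∉ clF M R := by
        intro h'
        have hsub : R ⊆ (insert z B \ coloops M G).erase c' := by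
          intro a ha
          have haC : a ∉ coloops M (insert z B \ coloops M G) := by
            rw [hRdef] at ha
            exact (Finset.mem_sdiff.1 ha).2
          exact Finset.mem_erase.2 ⟨fun h'' => haC (h'' ▸ hc'C), hRQ' ha⟩
        exact (mem_coloops.1 hc'C).2 (clF_mono hsub h')
      have hrk3 : rkN M (insert c' R) = 3 := by
        rw [rkN_insert_of_notMem_clF (hGg (hQG hc'Q)) hc'R, hR2]
      have hZG : insert e₀ (insert c' R) ⊆ G := by
        rw [← hZ]
        exact ((Finset.erase_subset _ _).trans (Finset.erase_subset _ _)).trans hQG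
      have hKZ : coloops M G ⊆ insert e₀ (insert c' R) := by
        rw [he₀]
        exact Finset.singleton_subset_iff.2 (Finset.mem_insert_self _ _)
      have hZK : insert e₀ (insert c' R) \ coloops M G = insert c' R := by
        ext a
        simp only [Finset.mem_sdiff, Finset.mem_insert, he₀, Finset.mem_singleton]
        constructor
        · rintro ⟨rfl | h', h2⟩
          · exact absurd rfl h2
          · exact h'
        · rintro (rfl | haR)
          · exact ⟨Or.inr (Or.inl rfl), fun h' => hc'K (by rw [he₀]; exact Finset.mem_singleton.2 h')⟩
          · exact ⟨Or.inr (Or.inr haR), fun h' => (Finset.mem_sdiff.1 (hRQ' haR)).2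
              (by rw [he₀]; exact Finset.mem_singleton.2 h')⟩
      have hrkZ : rkN M (insert e₀ (insert c' R)) = 4 := by
        rw [rkN_eq_rkN_sdiff_add_one hG hk hZG (Finset.Subset.refl _) hKZ, hZK, hrk3]
      -- modularity
      have hZsub₁ : ((insert z B).erase v).erase c ⊆ (insert z B).erase v := Finset.erase_subset _ _
      have hZsub₂ : ((insert z B).erase v).erase c ⊆ (insert z B).erase c := by
        intro a ha
        rw [Finset.mem_erase] at ha ⊢
        exact ⟨ha.1, (Finset.mem_erase.1 ha.2).2⟩
      have hmem := mem_clF_of_mem_clF_of_mem_clF (M := M) (X := (insert z B).erase v)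
        (Y := (insert z B).erase c) (Z := ((insert z B).erase v).erase c)
        (((Finset.erase_subset _ _).trans hQG).trans hGg) (((Finset.erase_subset _ _).trans hQG).trans hGg)
        hZsub₁ hZsub₂ (by rw [hunion, hrkQ, hrkv, hrkc, hZ, hrkZ]) hev hec
      rw [hZ] at hmem
      exact mem_clF_sdiff_coloops_of_mem_clF_insert hG he₀
        (Finset.insert_subset (Finset.mem_sdiff.2 ⟨hQG hc'Q, hc'K⟩)
          (hRQ'.trans (Finset.sdiff_subset_sdiff hQG (Finset.Subset.refl _)))) he hmem
    rcases hsecond with h₂ | h₃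
    · exact Or.inr (step c₂ c₃ hc₂C hc₃C hc₂v hc₃v hc23 hmemC h₂)
    · exact Or.inl (step c₃ c₂ hc₃C hc₂C hc₃v hc₂v (Ne.symm hc23)
        (fun a ha hav => (hmemC a ha hav).symm) h₃)

end PercRepro.Shadow
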